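import Literature.IUT.HodgeArakelov.LabelClassesOfCuspsNegative

/-!
# [IUTchII] Cor 2.4 (i) "(Inclusions and Conjugates)": the printed proof's deduction structure, PROVED parts, and the binder `□ ∈ {•t, ▶}`

S. Mochizuki, *Inter-universal Teichmüller theory II*, kurims manuscript (Dec. 2020), §2, Corollary 2.4 (i),
statement pp. 69–70, proof p. 70 l. −9 – p. 71 l. 6 ([IUTchII] Cor 2.4 (i), kurims pp.69-71)
[claim: Mochizuki2012, status: disputed] (D-0012 claim key; series status DISPUTED).  PROOF-ONLY companion of
`Literature.IUT.HodgeArakelov.LabelClassesOfCusps` (typer abc-iut-L6-t1, p407174; node `IUTchII:Cor2.4(i)`, decl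
`Cor24_i`): no new definitions, the landed module is not edited, nothing printed is asserted outright; imports the
negative companion `LabelClassesOfCuspsNegative` (p407862) only for the containment `PlusMinusTower.box_le_piV`.
(abc-iut cell, D-0067 cone discharge wave 4, seat abc-iut-w4-d012.)

PRINT (p. 70): "for `γ, γ' ∈ Δ̂^±_v`, the following three conditions are equivalent: (a) `γ' ∈ Δ^±_{v□}`;
(b) `I^{γ·γ'}_t ⊆ Π^γ_{v□}`; (c) `I^{γ·γ'}_t ⊆ (Π^±_{v□})^γ`" and its proof: "The implications (a) ⟹ (b) and
(b) ⟹ (c) are immediate from the definitions [cf. also Remark 2.3.1]. Thus, it suffices to verify that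
(c) ⟹ (a) … we may assume without loss of generality that `γ = 1`. Then by [IUTchI], Corollary 2.5 [cf. also
[IUTchI], Remark 2.5.2], the inclusion `I^{γ'}_t ⊆ Π^±_{v□} ⊆ Π^±_v` implies that `γ' ∈ Δ^±_v`. Now, by applying
the equivalence of [IUTchI], Corollary 2.3, (vi) [cf. also [CombGC], Proposition 1.2, (ii)], to the various
finite index open subgroups of `Δ^±_v`, it follows that `γ' ∈ Δ̂^±_{v□}` — where we use the notation "`∧`" to
denote the closure in `Δ̂^±_v` … — hence that `γ' ∈ Δ^±_{v□} = Δ̂^±_{v□} ∩ Δ^±_v` [cf. [IUTchI], Corollary 2.3,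
(v)]."

What this file kernel-checks, over ARBITRARY tower data `W : PlusMinusTower T`, `C : CuspidalInertiaData W`,
`H : Subgroup P` (the group `Π_{v□}`), `I : Subgroup Π̂^cor_v` — exactly the binders of the typed `Cor24_i`:

* `cor24_i_b_of_a`, `cor24_i_c_of_b` — the two "immediate" implications (a) ⟹ (b) ⟹ (c), PROVED (they are
  pure group theory: `γ'` normalises `Π_{v□}`, and `Π_{v□} ⊆ N_{Π^±_v}(Π_{v□})`);
* `cor24_i_iff_c_imp_a` — the typed predicate `Cor24_i W C H I` is EQUIVALENT to the single remaining
  implication (c) ⟹ (a) at `γ = 1` ("we may assume without loss of generality that `γ = 1`"), PROVED;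
* `cor24_i_of_inputs` — (c) ⟹ (a), hence `Cor24_i W C H I`, from the three printed inputs stated INLINE in the
  tower's language (never asserted; they are the [IUTchI] §2 nodes `IUTchI:Cor2.5`, `IUTchI:Cor2.3(vi)`,
  `IUTchI:Cor2.3(v)` — typed by abc-iut-L5-t1 over `StableCurveTemperedData` as `Cor25Inertia`, `Cor23vi`,
  `Cor23v` in `Literature/IUT/HodgeTheaters/TemperedCoverings.lean`; their instantiation on a `PlusMinusTower`
  is L5↔L6 merge debt, TODO-merge markers of `LabelClassesOfCusps`/`ThetaEvaluationSetting`):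
  (A) "`I^{γ'}_t ⊆ Π^±_v` implies `γ' ∈ Δ^±_v`" (Cor. 2.5); (B) "`γ' ∈ Δ̂^±_{v□}`", the closure (Cor. 2.3 (vi)
  applied to the finite index open subgroups); (C) "`Δ^±_{v□} = Δ̂^±_{v□} ∩ Δ^±_v`" (Cor. 2.3 (v));
* `not_cor24_i_of_pmBox_le_piV` — WHY THE PRINTED BINDER `□ ∈ {•t, ▶}` MATTERS.  The landed `Cor24_i` lets
  `H = Π_{v□}` range over ALL subgroups of `Π_v`, whereas print binds `□ ∈ {•t, ▶}` (the decomposition groups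
  `Π_{v•t}`, `Π_{v▶}` of Definition 2.3 (iv) / Remark 2.1.1, to which [IUTchI] Cor. 2.3 (vi) applies).  For a
  subgroup `Π_{v□}` with `Δ_v ⊆ N_{Π^±_v}(Π_{v□}) ⊆ Π_v` (e.g. an open normal subgroup of `Π_v` containing `I_t` that
  is not stable under the order-`l` outer action of `Gal(X̲̲_v/X_v) ≅ ℤ/lℤ` on `Π_v` — see the note "At the model"
  in the docstring of `not_cor24_i_of_pmBox_le_piV`: EXPECTED to exist at the intended model, not verified here),
  condition (c) holds for EVERY `γ' ∈ Δ^±_v` (as `Δ_v ⊲ Π^±_v`) while (a) forces `γ' ∈ Π_v`; so the typed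
  predicate FAILS as soon as `Δ_v ≠ Δ^±_v` (index `l`).  PROVED as a parametric negative over the tower
  (hypotheses: `Δ_v ⊆ N_{Π^±_v}(Π_{v□}) ⊆ Π_v`, `Δ_v` normalised by `Π^±_v`, some `γ' ∈ Δ^±_v ∖ Π_v`); REVISION
  2026-08-26: the first version of this docstring illustrated such `Π_{v□}` by the kernel of a Kummer character
  with residues "along the `Gal(X̲̲_v/X_v)`-orbit of cusps" — that illustration was WRONG (`X̲̲_v → X_v` is totally
  ramified at the cusps, [IUTchI] Def. 3.1 (e) "extracting an `l`-th root of the theta function", [IUTchII]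
  Rmk. 2.3.1 `I ∩ Π_v = I^l`, so `Gal(X̲̲_v/X_v)` FIXES every cusp; the `l` cusps are an orbit of
  `Δ̂^cor_v/Δ̂^±_v ≅ 𝔽_l^{⋊±}`, Cor. 2.4 (iii)) and is withdrawn; the kernel theorem is unchanged.  Typing record (finding of this seat, relayed to abc-iut-L6-t1 / abc-iut-L6-lead): the
  decl of record for the node should bind `H ∈ {Π_{v•t} (t = label of I_t), Π_{v▶}}`; the positive theorems
  above hold verbatim for that family.

Nothing here takes a side on [IUTchIII] Cor. 3.12; typed ≠ discharged: (c) ⟹ (a) for the printed family rests on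
the [IUTchI] §2 inputs (A)–(C), which are hypotheses here, not facts proved in this file.
-/

namespace Literature.IUT.HodgeArakelov

universe u

/-! ### Conjugation of subgroups (plain group theory) -/

section Conj

variable {G : Type u} [Group G]

/-- `(γ·γ')·K·(γ·γ')⁻¹ = γ·(γ'·K·γ'⁻¹)·γ⁻¹` on subgroups. [folklore] -/
private theorem map_conj_mul_eq_map_map (K : Subgroup G) (γ γ' : G) :
    K.map (MulAut.conj (γ * γ')).toMonoidHom =
      (K.map (MulAut.conj γ').toMonoidHom).map (MulAut.conj γ).toMonoidHom := by
  ext x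
  rw [Subgroup.mem_map_equiv, Subgroup.mem_map_equiv, Subgroup.mem_map_equiv, MulAut.conj_symm_apply,
    MulAut.conj_symm_apply, MulAut.conj_symm_apply, mul_inv_rev]
  constructor <;> intro h <;> simpa [mul_assoc] using h

/-- Conjugation by `γ` is monotone and reflects `≤` on subgroups: `γKγ⁻¹ ⊆ γLγ⁻¹ ↔ K ⊆ L`. [folklore] -/
private theorem map_conj_le_map_conj_iff (K L : Subgroup G) (γ : G) :
    K.map (MulAut.conj γ).toMonoidHom ≤ L.map (MulAut.conj γ).toMonoidHom ↔ K ≤ L :=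
  Subgroup.map_le_map_iff_of_injective (f := (MulAut.conj γ).toMonoidHom)
    (fun _ _ h => (MulAut.conj γ).injective h)

/-- "We may assume without loss of generality that `γ = 1`" (p. 70): `I^{γ·γ'} ⊆ K^γ ↔ I^{γ'} ⊆ K`.
([IUTchII] Cor 2.4 (i) p.70) [claim: Mochizuki2012, status: disputed] -/
theorem map_conj_mul_le_map_conj_iff (I K : Subgroup G) (γ γ' : G) :
    I.map (MulAut.conj (γ * γ')).toMonoidHom ≤ K.map (MulAut.conj γ).toMonoidHom ↔
      I.map (MulAut.conj γ').toMonoidHom ≤ K := by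
  rw [map_conj_mul_eq_map_map, map_conj_le_map_conj_iff]

/-- Membership in a conjugate: `y ∈ γKγ⁻¹ ↔ γ⁻¹yγ ∈ K`. [folklore] -/
private theorem mem_map_conj_iff (K : Subgroup G) (γ y : G) :
    y ∈ K.map (MulAut.conj γ).toMonoidHom ↔ γ⁻¹ * y * γ ∈ K := by
  rw [Subgroup.mem_map_equiv, MulAut.conj_symm_apply]

end Conj

/-! ### The groups of the tower: containments and the normaliser `Π^±_{v□} = N_{Π^±_v}(Π_{v□})` -/

namespace PlusMinusTower

variable {S : BadPlaceSetting.{u}} {P : TopGroup.{u}} {T : TemperedCoverings S P}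
  (W : PlusMinusTower T) (H : Subgroup P)

/-- `Π_v ⊆ Π^±_v` inside `Π̂^cor_v` (Def. 2.3 (i), p. 67: `Π_v → Π^±_v`). ([IUTchII] Def 2.3 (i) p.67)
[claim: Mochizuki2012, status: disputed] -/
theorem piV_le_piPM : W.piV ≤ W.piPM := by
  rintro _ ⟨x, rfl⟩
  exact ⟨T.incl x, rfl⟩

/-! `Π_{v□} ⊆ Π_v` is `PlusMinusTower.box_le_piV` of `LabelClassesOfCuspsNegative.lean` (abc-iut-L6-t19, p407862) —
imported, not re-declared. -/

/-- `Π_{v□} ⊆ Π^±_v`. ([IUTchII] Cor 2.4 p.69) [claim: Mochizuki2012, status: disputed] -/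
theorem box_le_piPM : W.box H ≤ W.piPM := (W.box_le_piV H).trans W.piV_le_piPM

/-- `Δ_{v□} ⊆ Π_{v□}`. ([IUTchII] Cor 2.4 p.69) [claim: Mochizuki2012, status: disputed] -/
theorem deltaBox_le_box : W.deltaBox H ≤ W.box H := inf_le_left

/-- `Π^±_v ⊆ Π̂^±_v`. ([IUTchII] Def 2.3 (i) p.67) [claim: Mochizuki2012, status: disputed] -/
theorem piPM_le_pmHat : W.piPM ≤ W.pmHat := W.emb_le_pmHat

/-- Membership in `Π^±_{v□} := N_{Π^±_v}(Π_{v□})` (Def. 2.3 (i) p. 67 / Cor. 2.4 p. 69, the normaliser being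
taken inside `Π^±_v`): `x ∈ Π^±_{v□}` iff `x ∈ Π^±_v` and `x` normalises `Π_{v□}`. ([IUTchII] Cor 2.4 p.69)
[claim: Mochizuki2012, status: disputed] -/
theorem mem_pmNormalizer_iff {x : W.Corhat} :
    x ∈ W.pmNormalizer H ↔ x ∈ W.piPM ∧ ∀ h : W.Corhat, h ∈ W.box H ↔ x * h * x⁻¹ ∈ W.box H := by
  have hbox : W.box H ≤ W.piPM := W.box_le_piPM H
  constructor
  · rintro ⟨y, hy, rfl⟩
    rw [SetLike.mem_coe, Subgroup.mem_normalizer_iff] at hy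
    refine ⟨y.2, fun h => ?_⟩
    constructor
    · intro hh
      have := (hy ⟨h, hbox hh⟩).mp (by simpa [Subgroup.mem_subgroupOf] using hh)
      simpa [Subgroup.mem_subgroupOf] using this
    · intro hh
      have hhpm : h ∈ W.piPM := by
        have h1 : (y : W.Corhat) * h * (y : W.Corhat)⁻¹ ∈ W.piPM := hbox hh
        have h2 : (y : W.Corhat)⁻¹ * ((y : W.Corhat) * h * (y : W.Corhat)⁻¹) * (y : W.Corhat) ∈ W.piPM :=
          W.piPM.mul_mem (W.piPM.mul_mem (W.piPM.inv_mem y.2) h1) y.2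
        have h3 : (y : W.Corhat)⁻¹ * ((y : W.Corhat) * h * (y : W.Corhat)⁻¹) * (y : W.Corhat) = h := by group
        rwa [h3] at h2
      have := (hy ⟨h, hhpm⟩).mpr (by simpa [Subgroup.mem_subgroupOf] using hh)
      simpa [Subgroup.mem_subgroupOf] using this
  · rintro ⟨hx, hn⟩
    refine ⟨⟨x, hx⟩, ?_, rfl⟩
    rw [SetLike.mem_coe, Subgroup.mem_normalizer_iff]
    intro h
    simpa [Subgroup.mem_subgroupOf] using hn h

/-- `Π^±_{v□} ⊆ Π^±_v`. ([IUTchII] Cor 2.4 p.69) [claim: Mochizuki2012, status: disputed] -/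
theorem pmNormalizer_le_piPM : W.pmNormalizer H ≤ W.piPM := fun _ hx => ((W.mem_pmNormalizer_iff H).mp hx).1

/-- `Π_{v□} ⊆ Π^±_{v□} = N_{Π^±_v}(Π_{v□})` (a group normalises itself; `Π_{v□} ⊆ Π^±_v`) — the content of
"(b) ⟹ (c) [is] immediate from the definitions" (p. 70). ([IUTchII] Cor 2.4 (i) p.70)
[claim: Mochizuki2012, status: disputed] -/
theorem box_le_pmNormalizer : W.box H ≤ W.pmNormalizer H := by
  intro x hx
  refine (W.mem_pmNormalizer_iff H).mpr ⟨W.box_le_piPM H hx, fun h => ?_⟩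
  constructor
  · intro hh
    exact (W.box H).mul_mem ((W.box H).mul_mem hx hh) ((W.box H).inv_mem hx)
  · intro hh
    have h2 : x⁻¹ * (x * h * x⁻¹) * x ∈ W.box H :=
      (W.box H).mul_mem ((W.box H).mul_mem ((W.box H).inv_mem hx) hh) hx
    have h3 : x⁻¹ * (x * h * x⁻¹) * x = h := by group
    rwa [h3] at h2

/-- An element of `Π^±_{v□}` conjugates `Π_{v□}` into itself: `γ' ∈ N_{Π^±_v}(Π_{v□}) ⟹ Π^{γ'}_{v□} ⊆ Π_{v□}` — the
content of "(a) ⟹ (b) [is] immediate from the definitions" (p. 70). ([IUTchII] Cor 2.4 (i) p.70)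
[claim: Mochizuki2012, status: disputed] -/
theorem map_conj_box_le_of_mem_pmNormalizer {γ' : W.Corhat} (hγ' : γ' ∈ W.pmNormalizer H) :
    (W.box H).map (MulAut.conj γ').toMonoidHom ≤ W.box H := by
  intro y hy
  rw [mem_map_conj_iff] at hy
  have hn := ((W.mem_pmNormalizer_iff H).mp hγ').2
  have h1 := (hn _).mp hy
  have h2 : γ' * (γ'⁻¹ * y * γ') * γ'⁻¹ = y := by group
  rwa [h2] at h1

end PlusMinusTower

/-! ### Cor. 2.4 (i): the implications (a) ⟹ (b) ⟹ (c), PROVED -/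

section Cor24i

variable {S : BadPlaceSetting.{u}} {P : TopGroup.{u}} {T : TemperedCoverings S P}
  (W : PlusMinusTower T) (C : CuspidalInertiaData W) (H : Subgroup P) (I : Subgroup W.Corhat)

/-- **IUTchII:Cor2.4(i)** (a) ⟹ (b), p. 70 "immediate from the definitions": if `γ' ∈ Π^±_{v□} = N_{Π^±_v}(Π_{v□})`
(in particular if `γ' ∈ Δ^±_{v□}`) and `I ⊆ Π_{v□}` (in particular `I ⊆ Δ_{v□}`), then `I^{γ·γ'} ⊆ Π^γ_{v□}` for
every `γ`.  PROVED for all tower data (no cuspidality needed). ([IUTchII] Cor 2.4 (i) p.70)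
[claim: Mochizuki2012, status: disputed] -/
theorem cor24_i_b_of_a {H : Subgroup P} {I : Subgroup W.Corhat} (hIH : I ≤ W.box H) (γ : W.Corhat)
    {γ' : W.Corhat} (ha : γ' ∈ W.pmBox H) :
    I.map (MulAut.conj (γ * γ')).toMonoidHom ≤ (W.box H).map (MulAut.conj γ).toMonoidHom := by
  rw [map_conj_mul_le_map_conj_iff]
  exact (Subgroup.map_mono hIH).trans (W.map_conj_box_le_of_mem_pmNormalizer H ha)

/-- **IUTchII:Cor2.4(i)** (b) ⟹ (c), p. 70 "immediate from the definitions": `I^{γ·γ'} ⊆ Π^γ_{v□}` implies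
`I^{γ·γ'} ⊆ (Π^±_{v□})^γ`, since `Π_{v□} ⊆ Π^±_{v□}`.  PROVED for all tower data. ([IUTchII] Cor 2.4 (i) p.70)
[claim: Mochizuki2012, status: disputed] -/
theorem cor24_i_c_of_b {H : Subgroup P} {I : Subgroup W.Corhat} {γ γ' : W.Corhat}
    (hb : I.map (MulAut.conj (γ * γ')).toMonoidHom ≤ (W.box H).map (MulAut.conj γ).toMonoidHom) :
    I.map (MulAut.conj (γ * γ')).toMonoidHom ≤ (W.pmBox H).map (MulAut.conj γ).toMonoidHom :=
  hb.trans (Subgroup.map_mono (W.box_le_pmNormalizer H))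

/-! ### Cor. 2.4 (i) reduces to (c) ⟹ (a) at `γ = 1`, PROVED -/

/-- **IUTchII:Cor2.4(i)**, reduction (p. 70: "it suffices to verify that (c) ⟹ (a) … we may assume without loss
of generality that `γ = 1`"): the typed predicate `Cor24_i W C H I` is EQUIVALENT to the single implication
"for `γ' ∈ Δ̂^±_v`, `I^{γ'} ⊆ Π^±_{v□}` implies `γ' ∈ Π^±_{v□}`" (under the typed hypotheses on `I`).  PROVED for
all tower data, from `cor24_i_b_of_a`, `cor24_i_c_of_b` and `I^{γ·γ'} ⊆ K^γ ↔ I^{γ'} ⊆ K`.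
([IUTchII] Cor 2.4 (i) p.70) [claim: Mochizuki2012, status: disputed] -/
theorem cor24_i_iff_c_imp_a :
    Literature.IUT.HodgeArakelov.Cor24_i W C H I ↔
      (C.IsCuspidalInertia W.piV I → I ≤ W.deltaBox H →
        ∀ γ' : W.Corhat, γ' ∈ W.pmHat ⊓ W.aug.ker →
          I.map (MulAut.conj γ').toMonoidHom ≤ W.pmBox H → γ' ∈ W.pmBox H) := by
  constructor
  · intro h hI hIΔ γ' hγ' hc
    obtain ⟨hab, hbc⟩ := h hI hIΔ 1 γ' (Subgroup.one_mem _) hγ'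
    have hc' : I.map (MulAut.conj (1 * γ')).toMonoidHom ≤ (W.pmBox H).map (MulAut.conj 1).toMonoidHom := by
      rw [map_conj_mul_le_map_conj_iff]; exact hc
    exact (Subgroup.mem_inf.mp (hab.mpr (hbc.mpr hc'))).1
  · intro h hI hIΔ γ γ' hγ hγ'
    have hIH : I ≤ W.box H := hIΔ.trans (W.deltaBox_le_box H)
    have key : I.map (MulAut.conj (γ * γ')).toMonoidHom ≤ (W.pmBox H).map (MulAut.conj γ).toMonoidHom →
        γ' ∈ W.deltaPmBox H := fun hc =>
      Subgroup.mem_inf.mpr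
        ⟨h hI hIΔ γ' hγ' ((map_conj_mul_le_map_conj_iff _ _ _ _).mp hc), (Subgroup.mem_inf.mp hγ').2⟩
    refine ⟨⟨fun ha => cor24_i_b_of_a W hIH γ (Subgroup.mem_inf.mp ha).1,
        fun hb => key (cor24_i_c_of_b W hb)⟩,
      ⟨fun hb => cor24_i_c_of_b W hb, fun hc => cor24_i_b_of_a W hIH γ (Subgroup.mem_inf.mp (key hc)).1⟩⟩

/-! ### (c) ⟹ (a) from the printed inputs [IUTchI] Cor. 2.5, Cor. 2.3 (vi), Cor. 2.3 (v) -/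

/-- **IUTchII:Cor2.4(i)** DISCHARGED MODULO the three [IUTchI] §2 inputs the printed proof (p. 70 l. −5 –
p. 71 l. 5) quotes, each stated inline in the tower's language (hypotheses, never asserted; nodes
`IUTchI:Cor2.5`, `IUTchI:Cor2.3(vi)`, `IUTchI:Cor2.3(v)` of abc-iut-L5-t1's `StableCurveTemperedData.Cor25Inertia`
/ `Cor23vi` / `Cor23v`, to be instantiated on the tower at the L5↔L6 merge):
(A) `h25` — "by [IUTchI], Corollary 2.5 …, the inclusion `I^{γ'}_t ⊆ Π^±_{v□} ⊆ Π^±_v` implies that `γ' ∈ Δ^±_v`":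
for `γ' ∈ Δ̂^±_v`, `I^{γ'} ⊆ Π^±_v ⟹ γ' ∈ Π^±_v`;
(B) `h23vi` — "by applying the equivalence of [IUTchI], Corollary 2.3, (vi) …, to the various finite index open
subgroups of `Δ^±_v`, it follows that `γ' ∈ Δ̂^±_{v□}`" (the closure of `Δ^±_{v□}`): for `γ' ∈ Δ^±_v`,
`I^{γ'} ⊆ Π^±_{v□} ⟹ γ' ∈ cl(Δ^±_{v□})`;
(C) `h23v` — "`Δ^±_{v□} = Δ̂^±_{v□} ∩ Δ^±_v` [cf. [IUTchI], Corollary 2.3, (v)]": `cl(Δ^±_{v□}) ∩ Δ^±_v ⊆ Δ^±_{v□}`.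
From (A)–(C): (c) ⟹ (a), hence (by `cor24_i_iff_c_imp_a`) the typed `Cor24_i W C H I`.  PROVED.
([IUTchII] Cor 2.4 (i) pp.70-71) [claim: Mochizuki2012, status: disputed] -/
theorem cor24_i_of_inputs
    (h25 : ∀ γ' : W.Corhat, γ' ∈ W.pmHat ⊓ W.aug.ker →
      I.map (MulAut.conj γ').toMonoidHom ≤ W.piPM → γ' ∈ W.piPM)
    (h23vi : ∀ γ' : W.Corhat, γ' ∈ W.piPM ⊓ W.aug.ker →
      I.map (MulAut.conj γ').toMonoidHom ≤ W.pmBox H → γ' ∈ closure (W.deltaPmBox H : Set W.Corhat))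
    (h23v : ∀ γ' : W.Corhat, γ' ∈ W.piPM ⊓ W.aug.ker →
      γ' ∈ closure (W.deltaPmBox H : Set W.Corhat) → γ' ∈ W.deltaPmBox H) :
    Literature.IUT.HodgeArakelov.Cor24_i W C H I := by
  rw [cor24_i_iff_c_imp_a]
  intro _ _ γ' hγ' hc
  have hpm : γ' ∈ W.piPM := h25 γ' hγ' (hc.trans (W.pmNormalizer_le_piPM H))
  have hΔ : γ' ∈ W.piPM ⊓ W.aug.ker := Subgroup.mem_inf.mpr ⟨hpm, (Subgroup.mem_inf.mp hγ').2⟩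
  exact (Subgroup.mem_inf.mp (h23v γ' hΔ (h23vi γ' hΔ hc))).1

/-! ### The printed binder `□ ∈ {•t, ▶}` is necessary: a parametric negative for general `Π_{v□}` -/

/-- **IUTchII:Cor2.4(i)**, TYPING RECORD (the binder `□ ∈ {•t, ▶}` is necessary).  Print binds `□ ∈ {•t, ▶}`; the
landed `Cor24_i` lets `H = Π_{v□}` be ANY subgroup of `Π_v`.  Suppose (as at the intended model, Def. 2.3 (i) p. 67:
`Π_v ⊲ Π^±_v` with `Π^±_v/Π_v ≅ Gal(X̲̲_v/X_v) ≅ ℤ/lℤ`) that `Δ_v = Π_v ∩ Δ̂^cor_v` is normalised by `Π^±_v`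
(`hnormal`) and that `Δ^±_v ⊄ Π_v` (some `γ' ∈ Δ^±_v ∖ Π_v`, `hγ'`, `hγ'V`), and let `Π_{v□} ⊆ Π_v` be a subgroup
containing the cuspidal inertia group `I ⊆ Δ_{v□}` whose normaliser satisfies `Δ_v ⊆ Π^±_{v□} = N_{Π^±_v}(Π_{v□}) ⊆ Π_v`
(`hΔN`, `hN`).  Then condition (c) holds for this `γ'`
(`I^{γ'} ⊆ Δ^{γ'}_v = Δ_v ⊆ Π^±_{v□}`) while (a) would give `γ' ∈ Π^±_{v□} ⊆ Π_v`: the typed `Cor24_i W C H I` FAILS.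
PROVED over the tower as a parametric negative.  AT THE MODEL (not verified here; REVISION 2026-08-26 replacing a
wrong illustration by a Kummer character "with residues along the `Gal(X̲̲_v/X_v)`-orbit of cusps" — `X̲̲_v → X_v` is
the `μ_l`-covering "obtained by extracting an `l`-th root of the theta function", [IUTchI] Def. 3.1 (e), TOTALLY
RAMIFIED at the cusps, [IUTchII] Rmk. 2.3.1 `I ∩ Π_v = I^l`, so `Gal(X̲̲_v/X_v)` fixes every cusp and that residue
argument does not apply): since `Π^±_v = Δ^±_v · Π_v` with `Π^±_v/Π_v ≅ ℤ/lℤ` of prime order, a subgroup `Π_{v□}` as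
above is the same thing as an OPEN NORMAL SUBGROUP `H ⊲ Π_v` containing `I_t` that is NOT stabilised by the order-`l`
outer automorphism `σ` of `Π_v` induced by `Gal(X̲̲_v/X_v)` (then `N_{Π^±_v}(H) = Π_v ⊇ Δ_v`); such `H` are EXPECTED
to exist (e.g. via the non-trivial action of `σ` on `H¹` of the compactification of `X̲̲_v`, a curve of genus `≥ 2` by
the total ramification, with coefficients `ℤ/n`, `n ≥ 3` prime to `lp` — Serre's rigidity lemma — combined with a
`G_v`-stable `σ`-unstable subspace), but no such `H` is constructed in the tree.  Consequence for the node
(independent of that expectation): the decl of record binds `H ∈ {Π_{v•t} (t the label class of I), Π_{v▶}}`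
(`Cor24_i'`, `LabelClassesOfCuspsR3.lean`) — for that family (c) ⟹ (a) is the content of [IUTchI] Cor. 2.3 (vi)
(`cor24_i_of_inputs`), and `cor24_i_b_of_a`, `cor24_i_c_of_b`, `cor24_i_iff_c_imp_a` apply verbatim.
([IUTchII] Cor 2.4 (i) pp.69-70) [claim: Mochizuki2012, status: disputed] -/
theorem not_cor24_i_of_pmBox_le_piV (hI : C.IsCuspidalInertia W.piV I) (hIΔ : I ≤ W.deltaBox H)
    (hN : W.pmBox H ≤ W.piV) (hΔN : W.piV ⊓ W.aug.ker ≤ W.pmBox H)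
    (hnormal : ∀ g : W.Corhat, g ∈ W.piPM →
      (W.piV ⊓ W.aug.ker).map (MulAut.conj g).toMonoidHom ≤ W.piV ⊓ W.aug.ker)
    {γ' : W.Corhat} (hγ' : γ' ∈ W.piPM ⊓ W.aug.ker) (hγ'V : γ' ∉ W.piV) :
    ¬ Literature.IUT.HodgeArakelov.Cor24_i W C H I := by
  rw [cor24_i_iff_c_imp_a]
  intro h
  have hIΔv : I ≤ W.piV ⊓ W.aug.ker :=
    le_inf (hIΔ.trans ((W.deltaBox_le_box H).trans (W.box_le_piV H))) (hIΔ.trans inf_le_right)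
  have hc : I.map (MulAut.conj γ').toMonoidHom ≤ W.pmBox H :=
    ((Subgroup.map_mono hIΔv).trans (hnormal γ' (Subgroup.mem_inf.mp hγ').1)).trans hΔN
  have hγ'hat : γ' ∈ W.pmHat ⊓ W.aug.ker :=
    Subgroup.mem_inf.mpr ⟨W.piPM_le_pmHat (Subgroup.mem_inf.mp hγ').1, (Subgroup.mem_inf.mp hγ').2⟩
  exact hγ'V (hN (h hI hIΔ γ' hγ'hat hc))

end Cor24i

end Literature.IUT.HodgeArakelov
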